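import Literature.NumberTheory.LFunctions.WeilFirstPrimeMinorant
import Literature.NumberTheory.LFunctions.WeilSharpConstants
import HarnessLib

/-!
# First-prime Weil positivity: the certificate and its soundness

The moment-method certificate of `WeilPositivityCertificate.lean` (Yoshida 1992, Thm 1, for the
archimedean cone `C((log 2)/2)`: Taylor expansion of the polar and frequency sides in the moments
`M_k = ∫ g (x/a₀)^k`, a certified minorant of the weight, Bessel's inequality and two kernel-checked
PSD blocks) transported to the FIRST-PRIME cone: the weight is
`w₂(t) = Re ψ(1/4 + it/2) − √2 log 2 cos(t log 2)` (minorant `cellsGamma₂` of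
`WeilFirstPrimeMinorant.lean`) and the support is a rational `b ≤ a₀` (for `log 2 < 2b ≤ log 3`
the analytic form is `Re W(g ⋆ g̃)`, `WeilFirstPrimeQuadratic.lean`).

* `WeilCert2` — a `WeilCert` (parameters `a₀, N, T, wL`, rounding, change of basis `C`, `D`,
  PSD factors `U`; its own `cells` field is unused) + the first-prime cells + the support `b`;
  `WeilCert2.nuQ/nuTab` (moments of the new minorant), `checkScalars` (`0 < b ≤ a₀ ≤ 1`, …),
  `check`;
* soundness **`WeilCert2.weilFirstPrimeQuadratic_nonneg_of_check`**:
  `c.check = true → ∀ g, IsWeilTest g → tsupport g ⊆ [-b, b] → 0 ≤ E₂(g)` (written out).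
  The algebraic core (`WeilCert.core_nonneg`), the polar and frequency Taylor bounds
  (`WeilAna.polar_lower_bound`, `WeilAna.freq_pointwise_bound`) and the Bessel step are those of
  the archimedean certificate, applied verbatim.

Everything here is proved; there are no named facts. Certificate data and kernel evaluations live
in sibling files.

## References

* H. Yoshida, *On Hermitian forms attached to zeta functions*, Adv. Stud. Pure Math. 21 (1992),
  §2 (2.1), §6, Theorem 1 (p. 310).
* A. Connes, C. Consani, *Spectral triples and ζ-cycles*, arXiv:2106.01715, §2.3 (the semi-local
  Weil quadratic form with one prime, numerically).
-/

noncomputable section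

open Complex Finset MeasureTheory Set Filter
open scoped Real Topology ComplexConjugate BigOperators

namespace Literature.NumberTheory.LFunctions

/-! ## The block machinery of `WeilCert` with an explicit `κ`

The archimedean certificate computes `κ` from its moment table (`WeilCert.kappaQ`); with a
signed minorant the `|γ|`-moment entering `κ` is no longer a table entry, so the blocks
`S' = Dᵀ P_r D + κ (2 diag b − (b bᵀ) ∘ H')`, `R = S' − UᵀU` and their checks and soundness are
re-stated with `κ` as a parameter (proofs verbatim; the archimedean versions `WeilCert.spBlk`,
`rBlk`, `checkBlock`, `core_nonneg` are the specialisation `κ = c.kappaQ nu`, so a librarian may later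
merge the two families). -/

namespace WeilCert

variable (c : WeilCert)

/-- `S' = Dᵀ P_r D + κ (2 diag b − (b bᵀ) ∘ H')`, materialized. [folklore] -/
def spBlkK (nu : List ℚ) (κ : ℚ) (p : ℕ) : List (List ℚ) :=
  let pd := c.pdBlk nu p
  let hp := c.hpBlk p
  tabM c.nb fun i j ↦
    (sumR c.nb fun k ↦ getM (c.Db p) k i * getM pd k j) +
      κ * ((if i = j then 2 * c.bQ p i else 0) - c.bQ p i * c.bQ p j * getM hp i j)

/-- `R = S' − Uᵀ U`, materialized. [folklore] -/
def rBlkK (nu : List ℚ) (κ : ℚ) (p : ℕ) : List (List ℚ) :=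
  let sp := c.spBlkK nu κ p
  tabM c.nb fun i j ↦ getM sp i j - sumR c.nb fun k ↦ getM (c.Ub p) k i * getM (c.Ub p) k j

/-- All checks of the parity block `p`. [folklore] -/
def checkBlockK (nu : List ℚ) (κ : ℚ) (p : ℕ) : Bool :=
  c.checkDC p && checkDom c.nb (c.rBlkK nu κ p)


section TablesK

variable (nu : List ℚ) (p : ℕ)

/-- Entries of the materialized `S'`. [folklore] -/
theorem getM_spBlkK (κ : ℚ) {i j : ℕ} (hi : i < c.nb) (hj : j < c.nb) :
    getM (c.spBlkK nu κ p) i j =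
      (∑ k ∈ range c.nb, getM (c.Db p) k i *
          ∑ l ∈ range c.nb, c.prQ nu (2 * k + p) (2 * l + p) * getM (c.Db p) l j) +
        κ * ((if i = j then 2 * c.bQ p i else 0) - c.bQ p i * c.bQ p j * getM (c.hpBlk p) i j) := by
  unfold spBlkK
  dsimp only
  rw [getM_tabM _ hi hj, sumR_eq_sum]
  congr 1
  exact Finset.sum_congr rfl fun k hk ↦ by rw [c.getM_pdBlk nu p (Finset.mem_range.1 hk) hj]

/-- Entries of the materialized `R = S' − UᵀU`. [folklore] -/
theorem getM_rBlkK (κ : ℚ) {i j : ℕ} (hi : i < c.nb) (hj : j < c.nb) :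
    getM (c.rBlkK nu κ p) i j =
      getM (c.spBlkK nu κ p) i j - ∑ k ∈ range c.nb, getM (c.Ub p) k i * getM (c.Ub p) k j := by
  unfold rBlkK
  dsimp only
  rw [getM_tabM _ hi hj, sumR_eq_sum]


end TablesK

variable {c}

/-! ### The algebraic core: per-parity reduction and positivity -/

/-- The real block matrix `S'_p` as a function. [folklore] -/
def spFunK (c : WeilCert) (nu : List ℚ) (κ : ℚ) (p : ℕ) (j j' : ℕ) : ℝ := (getM (c.spBlkK nu κ p) j j' : ℝ)

/-- **Block positivity** from the dominance check. [folklore] -/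
theorem spFunK_quad_nonneg {nu : List ℚ} {κ : ℚ} {p : ℕ} (h : c.checkBlockK nu κ p = true) (x : ℕ → ℝ) :
    0 ≤ ∑ i ∈ range c.nb, ∑ j ∈ range c.nb, spFunK c nu κ p i j * (x i * x j) := by
  unfold checkBlockK at h
  rw [Bool.and_eq_true] at h
  have hdom := h.2
  set R : ℕ → ℕ → ℝ := fun i j ↦ (getM (c.rBlkK nu κ p) i j : ℝ) with hR
  set U : ℕ → ℕ → ℝ := fun i j ↦ (getM (c.Ub p) i j : ℝ) with hU
  have hsplit : ∀ i ∈ range c.nb, ∀ j ∈ range c.nb,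
      spFunK c nu κ p i j = R i j + ∑ k ∈ range c.nb, U k i * U k j := by
    intro i hi j hj
    rw [hR, hU, spFunK]
    simp only
    rw [c.getM_rBlkK nu p κ (Finset.mem_range.1 hi) (Finset.mem_range.1 hj)]
    push_cast
    ring
  have h1 : ∑ i ∈ range c.nb, ∑ j ∈ range c.nb, spFunK c nu κ p i j * (x i * x j) =
      ∑ i ∈ range c.nb, ∑ j ∈ range c.nb, R i j * (x i * x j) +
        ∑ i ∈ range c.nb, ∑ j ∈ range c.nb, (∑ k ∈ range c.nb, U k i * U k j) * (x i * x j) := by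
    rw [← Finset.sum_add_distrib]
    refine Finset.sum_congr rfl fun i hi ↦ ?_
    rw [← Finset.sum_add_distrib]
    refine Finset.sum_congr rfl fun j hj ↦ ?_
    rw [hsplit i hi j hj]
    ring
  rw [h1]
  refine add_nonneg (WeilAlg.quad_nonneg_of_dominant c.nb R (fun i hi ↦ ?_) x)
    (WeilAlg.quad_gram_nonneg c.nb U x)
  have hd := of_checkDom hdom (Finset.mem_range.1 hi)
  rw [hR]
  simp only
  have : ∑ j ∈ range c.nb, (if j = i then (0 : ℝ) else
      (|((getM (c.rBlkK nu κ p) i j : ℚ) : ℝ)| + |((getM (c.rBlkK nu κ p) j i : ℚ) : ℝ)|) / 2) =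
      ((∑ j ∈ range c.nb, (if j = i then (0 : ℚ) else
        (|getM (c.rBlkK nu κ p) i j| + |getM (c.rBlkK nu κ p) j i|) / 2) : ℚ) : ℝ) := by
    push_cast
    refine Finset.sum_congr rfl fun j _ ↦ ?_
    split_ifs <;> simp
  rw [this]
  exact_mod_cast hd

/-- **Per-parity identity.** The block contributions equal `Re y* S'_p y`. [folklore] -/
theorem block_identityK {nu : List ℚ} (κ : ℚ) {p : ℕ} (hp : p < 2) (hDC : c.checkDC p = true) (M : ℕ → ℂ) :
    (∑ i ∈ range c.nb, ∑ i' ∈ range c.nb,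
        (c.prQ nu (2 * i + p) (2 * i' + p) : ℂ) * (conj (M (2 * i + p)) * M (2 * i' + p))) +
      (κ : ℂ) *
        (2 * ∑ i ∈ range c.nb, conj (c.uVec M (2 * i + p)) * M (2 * i + p) -
          ∑ i ∈ range c.nb, ∑ i' ∈ range c.nb,
            conj (c.uVec M (2 * i + p)) * c.uVec M (2 * i' + p) * (c.hBlkQ p i i' : ℂ)) =
      ∑ j ∈ range c.nb, ∑ j' ∈ range c.nb,
        (spFunK c nu κ p j j' : ℂ) * (conj (c.yVec M p j) * c.yVec M p j') := by
  set nb := c.nb with hnb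
  set y : ℕ → ℂ := c.yVec M p with hy
  set D : ℕ → ℕ → ℝ := fun i j ↦ (getM (c.Db p) i j : ℝ) with hD
  set C : ℕ → ℕ → ℝ := fun i j ↦ (getM (c.Cb p) i j : ℝ) with hC
  set b : ℕ → ℝ := fun j ↦ (c.bQ p j : ℝ) with hb
  -- (1) retraction: M(2i+p) = Σ_j D i j y j
  have hDC' : ∀ i ∈ range nb, ∀ i' ∈ range nb,
      ∑ j ∈ range nb, (D i j : ℂ) * C j i' = if i = i' then 1 else 0 := by
    intro i hi i' hi'
    have h := c.of_checkDC p hDC (Finset.mem_range.1 hi) (Finset.mem_range.1 hi')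
    rw [hD, hC]
    simp only
    have e : ∑ j ∈ range nb, (((getM (c.Db p) i j : ℚ) : ℝ) : ℂ) * (((getM (c.Cb p) j i' : ℚ) : ℝ) : ℂ)
        = (((∑ j ∈ range c.nb, getM (c.Db p) i j * getM (c.Cb p) j i' : ℚ) : ℝ) : ℂ) := by
      push_cast; rfl
    rw [e, h]
    push_cast
    split_ifs <;> simp
  have hret : ∀ i ∈ range nb, M (2 * i + p) = ∑ j ∈ range nb, (D i j : ℂ) * y j := by
    intro i hi
    rw [hy]
    unfold yVec
    rw [← hnb]
    have := WeilAlg.lin_retract nb D C (fun i' ↦ M (2 * i' + p)) hDC' hi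
    rw [hC] at this
    simp only at this
    rw [← this]
    rfl
  -- (2) the `P_r` term
  have hP : ∑ i ∈ range nb, ∑ i' ∈ range nb,
      (c.prQ nu (2 * i + p) (2 * i' + p) : ℂ) * (conj (M (2 * i + p)) * M (2 * i' + p)) =
      ∑ j ∈ range nb, ∑ j' ∈ range nb,
        (∑ i ∈ range nb, ∑ i' ∈ range nb,
          (D i j : ℂ) * (c.prQ nu (2 * i + p) (2 * i' + p) : ℂ) * D i' j') * (conj (y j) * y j') := by
    rw [← WeilAlg.quad_transform nb nb]
    refine Finset.sum_congr rfl fun i hi ↦ Finset.sum_congr rfl fun i' hi' ↦ ?_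
    rw [hret i hi, hret i' hi']
  -- (3) the `u`-terms
  have hu : ∀ i, c.uVec M (2 * i + p) = ∑ j ∈ range nb, ((C j i * b j : ℝ) : ℂ) * y j := by
    intro i
    rw [uVec_block M p i hp, hC, hb, hy, ← hnb]
    refine Finset.sum_congr rfl fun j _ ↦ ?_
    push_cast
    rfl
  have hu1 : 2 * ∑ i ∈ range nb, conj (c.uVec M (2 * i + p)) * M (2 * i + p) =
      ∑ j ∈ range nb, ∑ j' ∈ range nb,
        ((if j = j' then 2 * b j else 0 : ℝ) : ℂ) * (conj (y j) * y j') := by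
    have e1 : ∀ i ∈ range nb, conj (c.uVec M (2 * i + p)) * M (2 * i + p) =
        ∑ j ∈ range nb, (b j : ℂ) * conj (y j) * ((C j i : ℂ) * M (2 * i + p)) := by
      intro i _
      rw [hu i, map_sum, Finset.sum_mul]
      refine Finset.sum_congr rfl fun j _ ↦ ?_
      rw [map_mul, Complex.conj_ofReal]
      push_cast
      ring
    rw [Finset.sum_congr rfl e1, Finset.sum_comm]
    have e2 : ∀ j ∈ range nb, ∑ i ∈ range nb, (b j : ℂ) * conj (y j) * ((C j i : ℂ) * M (2 * i + p)) =
        (b j : ℂ) * conj (y j) * y j := by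
      intro j _
      rw [← Finset.mul_sum]
      congr 1
    rw [Finset.sum_congr rfl e2, Finset.mul_sum]
    refine Finset.sum_congr rfl fun j hj ↦ ?_
    have e3 : ∀ j' ∈ range nb, ((if j = j' then 2 * b j else 0 : ℝ) : ℂ) * (conj (y j) * y j') =
        if j = j' then (2 * b j : ℂ) * (conj (y j) * y j') else 0 := by
      intro j' _
      split_ifs
      · push_cast; ring
      · simp
    rw [Finset.sum_congr rfl e3, Finset.sum_ite_eq, if_pos hj]
    ring
  have hu2 : ∑ i ∈ range nb, ∑ i' ∈ range nb,
      conj (c.uVec M (2 * i + p)) * c.uVec M (2 * i' + p) * (c.hBlkQ p i i' : ℂ) =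
      ∑ j ∈ range nb, ∑ j' ∈ range nb,
        (∑ i ∈ range nb, ∑ i' ∈ range nb,
          ((C j i * b j : ℝ) : ℂ) * (c.hBlkQ p i i' : ℂ) * ((C j' i' * b j' : ℝ) : ℂ)) *
          (conj (y j) * y j') := by
    rw [← WeilAlg.quad_transform nb nb (fun i i' ↦ (c.hBlkQ p i i' : ℂ)) (fun i j ↦ C j i * b j) y]
    refine Finset.sum_congr rfl fun i _ ↦ Finset.sum_congr rfl fun i' _ ↦ ?_
    rw [hu i, hu i']
    ring
  rw [hP, hu1, hu2, mul_sub, Finset.mul_sum, Finset.mul_sum, ← Finset.sum_sub_distrib,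
    ← Finset.sum_add_distrib]
  refine Finset.sum_congr rfl fun j hj ↦ ?_
  rw [Finset.mul_sum, Finset.mul_sum, ← Finset.sum_sub_distrib, ← Finset.sum_add_distrib]
  refine Finset.sum_congr rfl fun j' hj' ↦ ?_
  -- entry identity
  have hS := c.getM_spBlkK nu p κ (Finset.mem_range.1 hj) (Finset.mem_range.1 hj')
  have hH := c.getM_hpBlk p (Finset.mem_range.1 hj) (Finset.mem_range.1 hj')
  rw [spFunK, hS]
  have eP : ∑ i ∈ range nb, ∑ i' ∈ range nb,
      (D i j : ℂ) * (c.prQ nu (2 * i + p) (2 * i' + p) : ℂ) * D i' j' =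
      (((∑ k ∈ range c.nb, getM (c.Db p) k j *
        ∑ l ∈ range c.nb, c.prQ nu (2 * k + p) (2 * l + p) * getM (c.Db p) l j' : ℚ) : ℝ) : ℂ) := by
    rw [hD]
    push_cast
    rw [← hnb]
    refine Finset.sum_congr rfl fun i _ ↦ ?_
    rw [Finset.mul_sum]
    refine Finset.sum_congr rfl fun i' _ ↦ ?_
    ring
  have eH : ∑ i ∈ range nb, ∑ i' ∈ range nb,
      ((C j i * b j : ℝ) : ℂ) * (c.hBlkQ p i i' : ℂ) * ((C j' i' * b j' : ℝ) : ℂ) =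
      (b j : ℂ) * b j' * (((getM (c.hpBlk p) j j' : ℚ) : ℝ) : ℂ) := by
    rw [hH, hC, hb]
    push_cast
    rw [← hnb, Finset.mul_sum, Finset.sum_comm]
    refine Finset.sum_congr rfl fun i' _ ↦ ?_
    rw [Finset.sum_mul, Finset.mul_sum]
    refine Finset.sum_congr rfl fun i _ ↦ ?_
    ring
  rw [eP, eH, hb]
  split_ifs <;> push_cast <;> ring

/-- **The algebraic core.** With `N + 1 = 2 nb`, both blocks checked and `κ ≥ 0`... (κ sign not
needed here): the reduced form plus `κ ×` the Bessel expression is `Σ_p Re y_p* S'_p y_p ≥ 0`. [folklore] -/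
theorem core_nonnegK {nu : List ℚ} {κ : ℚ} (hN : c.N + 1 = 2 * c.nb) (hb0 : c.checkBlockK nu κ 0 = true)
    (hb1 : c.checkBlockK nu κ 1 = true) (a : ℝ) (ha : (c.a0 : ℝ) = a) (M : ℕ → ℂ) :
    0 ≤ (∑ k ∈ range (c.N + 1), ∑ l ∈ range (c.N + 1),
        (c.prQ nu k l : ℝ) * (conj (M k) * M l).re) +
      (κ : ℝ) *
        (2 * (∑ k ∈ range (c.N + 1), conj (c.uVec M k) * M k).re -
          (∑ k ∈ range (c.N + 1), ∑ l ∈ range (c.N + 1),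
            conj (c.uVec M k) * c.uVec M l * (gramH a k l : ℂ)).re) := by
  have hDC0 : c.checkDC 0 = true := by
    unfold checkBlockK at hb0; rw [Bool.and_eq_true] at hb0; exact hb0.1
  have hDC1 : c.checkDC 1 = true := by
    unfold checkBlockK at hb1; rw [Bool.and_eq_true] at hb1; exact hb1.1
  -- rewrite everything as the real part of one complex expression
  have key : (∑ k ∈ range (c.N + 1), ∑ l ∈ range (c.N + 1),
        (c.prQ nu k l : ℝ) * (conj (M k) * M l).re) +
      (κ : ℝ) *
        (2 * (∑ k ∈ range (c.N + 1), conj (c.uVec M k) * M k).re -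
          (∑ k ∈ range (c.N + 1), ∑ l ∈ range (c.N + 1),
            conj (c.uVec M k) * c.uVec M l * (gramH a k l : ℂ)).re) =
      ((∑ k ∈ range (c.N + 1), ∑ l ∈ range (c.N + 1),
          (c.prQ nu k l : ℂ) * (conj (M k) * M l)) +
        (κ : ℂ) *
          (2 * ∑ k ∈ range (c.N + 1), conj (c.uVec M k) * M k -
            ∑ k ∈ range (c.N + 1), ∑ l ∈ range (c.N + 1),
              conj (c.uVec M k) * c.uVec M l * (gramH a k l : ℂ))).re := by
    have e1 : (∑ k ∈ range (c.N + 1), ∑ l ∈ range (c.N + 1),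
        (c.prQ nu k l : ℂ) * (conj (M k) * M l)).re =
        ∑ k ∈ range (c.N + 1), ∑ l ∈ range (c.N + 1), (c.prQ nu k l : ℝ) * (conj (M k) * M l).re := by
      rw [Complex.re_sum]
      refine Finset.sum_congr rfl fun k _ ↦ ?_
      rw [Complex.re_sum]
      refine Finset.sum_congr rfl fun l _ ↦ ?_
      rw [show ((c.prQ nu k l : ℚ) : ℂ) = (((c.prQ nu k l : ℚ) : ℝ) : ℂ) by norm_cast,
        Complex.re_ofReal_mul]
    have e2 : ∀ (κ : ℚ) (X Y : ℂ), ((κ : ℂ) * (2 * X - Y)).re = (κ : ℝ) * (2 * X.re - Y.re) := by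
      intro κ X Y
      rw [show ((κ : ℚ) : ℂ) = (((κ : ℚ) : ℝ) : ℂ) by norm_cast, Complex.re_ofReal_mul]
      congr 1
      simp [Complex.mul_re]
    rw [Complex.add_re, e1, e2]
  rw [key]
  -- parity split
  have hH : ∀ k l, k % 2 ≠ l % 2 → (gramH a k l : ℂ) = 0 := by
    intro k l hkl
    have hodd : Odd (k + l) := by
      rcases Nat.even_or_odd k with hk | hk <;> rcases Nat.even_or_odd l with hl | hl
      · exact absurd (by rw [Nat.even_iff.1 hk, Nat.even_iff.1 hl]) hkl
      · exact hk.add_odd hl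
      · exact hk.add_even hl
      · exact absurd (by rw [Nat.odd_iff.1 hk, Nat.odd_iff.1 hl]) hkl
    rw [gramH, hodd.neg_one_pow]
    simp
  rw [hN, WeilAlg.sum_sum_range_two_mul c.nb _ (fun k l hkl ↦ by
      rw [c.prQ_cross nu hkl]; simp),
    WeilAlg.sum_range_two_mul c.nb,
    WeilAlg.sum_sum_range_two_mul c.nb _ (fun k l hkl ↦ by rw [hH k l hkl]; simp)]
  -- the Gram entries on the blocks
  have hG : ∀ p i i', p < 2 → (gramH a (2 * i + p) (2 * i' + p) : ℂ) = (c.hBlkQ p i i' : ℂ) := by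
    intro p i i' hp
    have hev : Even (2 * i + p + (2 * i' + p)) := ⟨i + i' + p, by ring⟩
    rw [gramH, hev.neg_one_pow, hBlkQ, ← ha]
    push_cast
    ring
  have e0 := c.block_identityK (nu := nu) κ (p := 0) (by norm_num) hDC0 M
  have e1 := c.block_identityK (nu := nu) κ (p := 1) (by norm_num) hDC1 M
  simp only [add_zero] at e0
  have hG0 : ∀ i i', (gramH a (2 * i) (2 * i') : ℂ) = (c.hBlkQ 0 i i' : ℂ) := fun i i' ↦ by
    simpa using hG 0 i i' (by norm_num)
  have hG1 : ∀ i i', (gramH a (2 * i + 1) (2 * i' + 1) : ℂ) = (c.hBlkQ 1 i i' : ℂ) := fun i i' ↦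
    hG 1 i i' (by norm_num)
  simp_rw [hG0, hG1]
  have etot : (∑ i ∈ range c.nb, ∑ j ∈ range c.nb,
        (c.prQ nu (2 * i) (2 * j) : ℂ) * (conj (M (2 * i)) * M (2 * j)) +
      ∑ i ∈ range c.nb, ∑ j ∈ range c.nb,
        (c.prQ nu (2 * i + 1) (2 * j + 1) : ℂ) * (conj (M (2 * i + 1)) * M (2 * j + 1))) +
      (κ : ℂ) *
        (2 * (∑ i ∈ range c.nb, conj (c.uVec M (2 * i)) * M (2 * i) +
            ∑ i ∈ range c.nb, conj (c.uVec M (2 * i + 1)) * M (2 * i + 1)) -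
          (∑ i ∈ range c.nb, ∑ j ∈ range c.nb,
              conj (c.uVec M (2 * i)) * c.uVec M (2 * j) * (c.hBlkQ 0 i j : ℂ) +
            ∑ i ∈ range c.nb, ∑ j ∈ range c.nb,
              conj (c.uVec M (2 * i + 1)) * c.uVec M (2 * j + 1) * (c.hBlkQ 1 i j : ℂ))) =
      (∑ j ∈ range c.nb, ∑ j' ∈ range c.nb,
        (spFunK c nu κ 0 j j' : ℂ) * (conj (c.yVec M 0 j) * c.yVec M 0 j')) +
      ∑ j ∈ range c.nb, ∑ j' ∈ range c.nb,
        (spFunK c nu κ 1 j j' : ℂ) * (conj (c.yVec M 1 j) * c.yVec M 1 j') := by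
    rw [← e0, ← e1]
    ring
  rw [etot, Complex.add_re]
  exact add_nonneg
    (WeilAlg.re_herm_nonneg c.nb _ (fun x ↦ c.spFunK_quad_nonneg hb0 x) _)
    (WeilAlg.re_herm_nonneg c.nb _ (fun x ↦ c.spFunK_quad_nonneg hb1 x) _)






end WeilCert

/-- A certificate for first-prime Weil positivity on `C(b)`, `b ≤ a₀`: the archimedean
certificate format (whose `cells` field is unused here) + first-prime cells + the support `b`. [folklore] -/
structure WeilCert2 where
  /-- parameters, rounding, change of basis and PSD factors (format of `WeilCert`) -/
  base : WeilCert
  /-- the cells of the first-prime minorant on `[0, T]` -/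
  cells : List FPDCell
  /-- the support half-length of the target cone (`tsupport g ⊆ [-b, b]`, `b ≤ a₀`) -/
  b : ℚ
  /-- the claimed table of moments `ν_q`, `q ≤ 2N` (verified against `nuQ` by `checkNu`; supplied as
  data so that the kernel evaluates each moment once, in its own declaration) -/
  nuData : List ℚ

namespace WeilCert2

variable (c : WeilCert2)

/-- The scaled moments `ν_q = a₀^q ∫ γ(t) t^q dt` of the first-prime minorant. [folklore] -/
def nuQ (q : ℕ) : ℚ := c.base.a0 ^ q * (2 * cellsMomentQ₂ c.base.wL c.cells q)

/-- Table of `ν_q`, `q ≤ 2N`: the claimed data (see `checkNu`). [folklore] -/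
def nuTab : List ℚ := c.nuData

/-- Entry `q` of the claimed moment table is the moment `ν_q`. [folklore] -/
def checkNuAt (q : ℕ) : Bool := decide (getV c.nuData q = c.nuQ q)

/-- The claimed moment table is correct at the even indices `q ≤ 2N` (the only ones the reduced
quadratic form reads). [folklore] -/
def checkNu : Bool := allBelow (c.base.N + 1) fun j ↦ c.checkNuAt (2 * j)

/-- `ν'_abs = 2 a₀^{N+1} · (2 Σ_j bnd_j ∫_{cell j} s^{N+1}) / (N+1)!`: the `|γ|`-moment bound of the Taylor
remainder on the frequency side (signed minorant). [folklore] -/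
def nuPrimeAbs : ℚ :=
  2 * (c.base.a0 ^ (c.base.N + 1) * (2 * cellsAbsMomentQ c.base.wL c.cells (c.base.N + 1))) /
    (c.base.N + 1).factorial

/-- The coefficient of `‖g‖₂²` after all reductions, before rounding: level minus `log π`, minus
the price `7 (q_hi − q_lo) Σ_j bnd_j` of replacing `1/(2π)` by rationals against a SIGNED `γ`
(`q_lo = invTwoPiLo20` of `WeilSharpConstants.lean`), minus the Taylor/rounding remainders. [folklore] -/
def kappaExact : ℚ :=
  c.base.wL - logPiHi - 7 * (invTwoPiHi - invTwoPiLo20) * cellsBndSumQ c.base.wL c.cells -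
    2 * c.base.a0 * (c.base.etaP + 5 * invTwoPiHi * c.nuPrimeAbs + ((c.base.N : ℚ) + 1) ^ 2 / 2 ^ c.base.pg)

/-- `κ = rd(κ_exact)`. [folklore] -/
def kappaQ : ℚ := ratRd c.base.pg c.kappaExact

/-- Scalar side conditions (`0 < b ≤ a₀ ≤ 1`, frequency cut-off vs `N`, Taylor remainder `≤ 1`,
even `N + 1`, `κ ≥ 0`). [folklore] -/
def checkScalars : Bool :=
  decide (0 < c.b) && decide (c.b ≤ c.base.a0) && decide (c.base.a0 ≤ 1) && decide (0 < c.base.T) &&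
    decide (2 * c.base.a0 * c.base.T ≤ (c.base.N : ℚ) + 2) &&
    decide (2 * (c.base.a0 * c.base.T) ^ (c.base.N + 1) / (c.base.N + 1).factorial ≤ 1) &&
    decide (c.base.N + 1 = 2 * c.base.nb) && decide (0 ≤ c.kappaQ)

/-- **The checker.** [folklore] -/
def check : Bool :=
  checkCells₂ c.base.prec c.base.wL c.base.T c.base.mwT c.cells && c.checkScalars && c.checkNu &&
    c.base.checkBlockK c.nuTab c.kappaQ 0 && c.base.checkBlockK c.nuTab c.kappaQ 1

end WeilCert2

namespace WeilCert2

variable {c : WeilCert2}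

/-- Unpacking `check`. [folklore] -/
theorem check_spec (h : c.check = true) :
    checkCells₂ c.base.prec c.base.wL c.base.T c.base.mwT c.cells = true ∧ c.checkScalars = true ∧
      c.checkNu = true ∧
      c.base.checkBlockK c.nuTab c.kappaQ 0 = true ∧ c.base.checkBlockK c.nuTab c.kappaQ 1 = true := by
  unfold check at h
  simp only [Bool.and_eq_true] at h
  exact ⟨h.1.1.1.1, h.1.1.1.2, h.1.1.2, h.1.2, h.2⟩

/-- Unpacking `checkScalars`. [folklore] -/
theorem scalars_spec (h : c.checkScalars = true) :
    0 < c.b ∧ c.b ≤ c.base.a0 ∧ c.base.a0 ≤ 1 ∧ 0 < c.base.T ∧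
      2 * c.base.a0 * c.base.T ≤ (c.base.N : ℚ) + 2 ∧
      2 * (c.base.a0 * c.base.T) ^ (c.base.N + 1) / (c.base.N + 1).factorial ≤ 1 ∧
      c.base.N + 1 = 2 * c.base.nb ∧ 0 ≤ c.kappaQ := by
  unfold checkScalars at h
  simp only [Bool.and_eq_true, decide_eq_true_eq] at h
  exact ⟨h.1.1.1.1.1.1.1, h.1.1.1.1.1.1.2, h.1.1.1.1.1.2, h.1.1.1.1.2, h.1.1.1.2, h.1.1.2, h.1.2, h.2⟩

/-- `allBelow` from a pointwise family of checks. [folklore] -/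
theorem allBelow_of_forall {n : ℕ} {P : ℕ → Bool} (h : ∀ k < n, P k = true) : allBelow n P = true := by
  induction n with
  | zero => rfl
  | succ n ih =>
    rw [allBelow_succ, Bool.and_eq_true]
    exact ⟨ih fun k hk ↦ h k (by omega), h n (by omega)⟩

/-- The table of moments agrees with `nuQ` at even `q ≤ 2N`. [folklore] -/
theorem getV_nuTab (h : c.checkNu = true) {q : ℕ} (hq : q ≤ 2 * c.base.N) (he : q % 2 = 0) :
    getV c.nuTab q = c.nuQ q := by
  unfold checkNu at h
  have := of_allBelow h (k := q / 2) (by omega)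
  unfold checkNuAt at this
  rw [show 2 * (q / 2) = q by omega] at this
  simpa [nuTab] using this

/-! ### Moments of the minorant, all parities -/

/-- `γ` is even. [folklore] -/
theorem cellsGamma₂_neg (wL : ℚ) (cells : List FPDCell) (t : ℝ) :
    cellsGamma₂ wL cells (-t) = cellsGamma₂ wL cells t := by
  unfold cellsGamma₂; rw [abs_neg]

/-- `∫ γ(t) t^q dt = 2 Σ_j momentQ_j(q)` for even `q`, `= 0` for odd `q`; and integrability. [folklore] -/
theorem integral_gamma_pow (hcells : checkCells₂ c.base.prec c.base.wL c.base.T c.base.mwT c.cells = true) (q : ℕ) :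
    Integrable (fun t ↦ cellsGamma₂ c.base.wL c.cells t * t ^ q) ∧
      ∫ t, cellsGamma₂ c.base.wL c.cells t * t ^ q =
        if Even q then 2 * (cellsMomentQ₂ c.base.wL c.cells q : ℝ) else 0 := by
  rcases Nat.even_or_odd q with hq | hq
  · rw [if_pos hq]; exact integral_cellsGamma₂_mul_pow hcells hq
  · rw [if_neg (Nat.not_even_iff_odd.2 hq)]
    have h0 := (integral_abs_cellsGamma₂_mul_pow_le hcells (Even.zero)).1
    have h1 := (integral_abs_cellsGamma₂_mul_pow_le hcells (hq.add_one)).1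
    simp only [pow_zero, mul_one] at h0
    set γ := cellsGamma₂ c.base.wL c.cells with hγ
    have hint : Integrable (fun t ↦ γ t * t ^ q) := by
      refine Integrable.mono' (h0.add h1)
        (((measurable_cellsGamma₂ _ _).mul (measurable_id.pow_const q)).aestronglyMeasurable)
        (Eventually.of_forall fun t ↦ ?_)
      rw [Real.norm_eq_abs, abs_mul]
      simp only [Pi.add_apply]
      rw [show |γ t| + |γ t| * t ^ (q + 1) = |γ t| * (1 + t ^ (q + 1)) by ring]
      refine mul_le_mul_of_nonneg_left ?_ (abs_nonneg _)
      rw [abs_pow]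
      rcases le_or_gt |t| 1 with ht | ht
      · have : |t| ^ q ≤ 1 := pow_le_one₀ (abs_nonneg t) ht
        have : 0 ≤ t ^ (q + 1) := by rw [← (hq.add_one).pow_abs]; positivity
        linarith
      · have : |t| ^ q ≤ |t| ^ (q + 1) := pow_le_pow_right₀ ht.le (Nat.le_succ q)
        rw [(hq.add_one).pow_abs] at this
        linarith
    refine ⟨hint, ?_⟩
    have hodd : ∀ t, γ (-t) * (-t) ^ q = -(γ t * t ^ q) := by
      intro t; rw [hγ, cellsGamma₂_neg, hq.neg_pow]; ring
    have h := integral_neg_eq_self (fun t ↦ γ t * t ^ q) volume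
    simp_rw [hodd] at h
    rw [integral_neg] at h
    linarith

/-- `ν_q = a₀^q ∫ γ(t) t^q dt` for even `q`. [folklore] -/
theorem nuQ_eq_integral (hcells : checkCells₂ c.base.prec c.base.wL c.base.T c.base.mwT c.cells = true) {q : ℕ}
    (hq : Even q) :
    ((c.nuQ q : ℚ) : ℝ) = (c.base.a0 : ℝ) ^ q * ∫ t, cellsGamma₂ c.base.wL c.cells t * t ^ q := by
  rw [(integral_gamma_pow hcells q).2, if_pos hq]
  unfold nuQ; push_cast; ring

/-! ### Step C: the frequency side -/

variable {g : ℝ → ℂ}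

/-- The matrix `Ĝ` of the frequency side. [folklore] -/
def gHat (c : WeilCert2) (k l : ℕ) : ℝ :=
  if k % 2 = l % 2 then
    (-1 : ℝ) ^ k * (-1) ^ ((k + l) / 2) * ((c.nuQ (k + l) : ℚ) : ℝ) / (k.factorial * l.factorial)
  else 0

/-- Two-sided error algebra of the frequency side: if `‖φ‖ ≤ L`, `‖φ − p‖ ≤ ρL`, `0 ≤ ρ ≤ 1`, `L ≥ 0`
then `|‖φ‖² − ‖p‖²| ≤ 5ρL²`. [folklore] -/
theorem freq_error_abs {φ p : ℂ} {L ρ : ℝ} (hL : 0 ≤ L) (hρ : 0 ≤ ρ) (hρ1 : ρ ≤ 1) (hφ : ‖φ‖ ≤ L)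
    (hp : ‖φ - p‖ ≤ ρ * L) : |‖φ‖ ^ 2 - ‖p‖ ^ 2| ≤ 5 * ρ * L ^ 2 := by
  have hup := WeilAna.freq_error hL hρ hρ1 hφ hp
  have hpn : ‖p‖ ≤ ‖φ‖ + ρ * L := by
    have : p = φ - (φ - p) := by ring
    rw [this]
    exact (norm_sub_le _ _).trans (by linarith)
  have hlow : ‖p‖ ^ 2 - ‖φ‖ ^ 2 ≤ 5 * ρ * L ^ 2 := by
    have h1 : ‖p‖ ^ 2 ≤ (‖φ‖ + ρ * L) ^ 2 := pow_le_pow_left₀ (norm_nonneg _) hpn 2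
    have h2 : (‖φ‖ + ρ * L) ^ 2 - ‖φ‖ ^ 2 = ρ * L * (2 * ‖φ‖ + ρ * L) := by ring
    have h3 : ρ * L * (2 * ‖φ‖ + ρ * L) ≤ ρ * L * (2 * L + 1 * L) :=
      mul_le_mul_of_nonneg_left (by nlinarith) (by positivity)
    nlinarith
  rw [abs_le]
  constructor <;> linarith

/-- **Two-sided frequency-side pointwise bound.** For `tsupport g ⊆ [-a, a]`, `2a|t| ≤ N + 2` and
`ρ_t = 2(|t|a)^{N+1}/(N+1)! ≤ 1`:
`|‖ĝ(1/2+it)‖² − Σ_{k,l≤N} Re((−1)^k I^{k+l} conj M_k M_l) (ta)^{k+l}/(k!l!)| ≤ 5 ρ_t ‖g‖₁²`. [folklore] -/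
theorem freq_pointwise_bound_abs {g : ℝ → ℂ} (hg : IsWeilTest g) {a : ℝ} (ha : 0 < a)
    (hsupp : tsupport g ⊆ Icc (-a) a) (N : ℕ) {t : ℝ} (ht : 2 * a * |t| ≤ N + 2)
    (hρt : 2 * (|t| * a) ^ (N + 1) / (N + 1).factorial ≤ 1) :
    |‖weilMellin g (1 / 2 + t * I)‖ ^ 2 -
      ∑ k ∈ range (N + 1), ∑ l ∈ range (N + 1),
          (((-1 : ℂ) ^ k * I ^ (k + l)) * (conj (weilMoment a g k) * weilMoment a g l)).re *
            ((t * a) ^ (k + l) / (k.factorial * l.factorial))| ≤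
        5 * (2 * (|t| * a) ^ (N + 1) / (N + 1).factorial) * weilNorm1 g ^ 2 := by
  set L := weilNorm1 g with hL
  have hL0 : 0 ≤ L := weilNorm1_nonneg g
  have hc : ‖(t : ℂ) * I‖ * a / (N + 2) ≤ 1 / 2 := by
    rw [show ‖(t : ℂ) * I‖ = |t| by simp]
    rw [div_le_iff₀ (by positivity)]
    linarith
  have h := norm_weilMellin_sub_sum_weilMoment_le hg ha hsupp ((t : ℂ) * I) N hc
  rw [show ‖(t : ℂ) * I‖ = |t| by simp, show (t : ℂ) * I + 1 / 2 = 1 / 2 + t * I by ring] at h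
  set p : ℂ := ∑ m ∈ range (N + 1), ((t : ℂ) * I * a) ^ m / m.factorial * weilMoment a g m with hp
  have hφ := norm_weilMellin_half_line_le hg t
  have hmain := freq_error_abs (φ := weilMellin g (1 / 2 + t * I)) (p := p) hL0 (by positivity) hρt hφ
    (by rw [hp]; exact h)
  have hp2 : ‖p‖ ^ 2 = ∑ k ∈ range (N + 1), ∑ l ∈ range (N + 1),
      (((-1 : ℂ) ^ k * I ^ (k + l)) * (conj (weilMoment a g k) * weilMoment a g l)).re *
        ((t * a) ^ (k + l) / (k.factorial * l.factorial)) := by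
    rw [hp, WeilAna.norm_sq_sum_eq]
    refine Finset.sum_congr rfl fun k _ ↦ Finset.sum_congr rfl fun l _ ↦ ?_
    rw [WeilAna.conj_tau_mul_tau]
    rw [show ((-1 : ℂ) ^ k * I ^ (k + l)) * (((t * a) ^ (k + l) / (k.factorial * l.factorial) : ℝ) : ℂ) *
        (conj (weilMoment a g k) * weilMoment a g l) =
        ((-1 : ℂ) ^ k * I ^ (k + l)) * (conj (weilMoment a g k) * weilMoment a g l) *
          (((t * a) ^ (k + l) / (k.factorial * l.factorial) : ℝ) : ℂ) by ring, Complex.re_mul_ofReal]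
  rw [← hp2]
  exact hmain

/-- **Frequency bound (signed minorant).**
`∫ ‖ĝ(1/2+it)‖² γ(t) dt ≤ Σ Ĝ_{kl} Re(conj M_k M_l) + 5 ‖g‖₁² ν'_abs`. [folklore] -/
theorem freq_integral_bound (hcells : checkCells₂ c.base.prec c.base.wL c.base.T c.base.mwT c.cells = true)
    (hsc : c.checkScalars = true) (hg : IsWeilTest g)
    (hsupp : tsupport g ⊆ Icc (-(c.base.a0 : ℝ)) c.base.a0) :
    ∫ t : ℝ, ‖weilMellin g (1 / 2 + t * I)‖ ^ 2 * cellsGamma₂ c.base.wL c.cells t ≤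
      ∑ k ∈ range (c.base.N + 1), ∑ l ∈ range (c.base.N + 1),
          gHat c k l * (conj (weilMoment c.base.a0 g k) * weilMoment c.base.a0 g l).re +
        5 * weilNorm1 g ^ 2 * ((c.nuPrimeAbs : ℚ) : ℝ) := by
  obtain ⟨hb0, hba, ha1, hT, haT, hρT, hN, -⟩ := scalars_spec hsc
  set a : ℝ := (c.base.a0 : ℝ) with ha_def
  have ha : 0 < a := by
    have h1 : (0 : ℝ) < c.b := by exact_mod_cast hb0
    have h2 : ((c.b : ℚ) : ℝ) ≤ c.base.a0 := by exact_mod_cast hba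
    rw [ha_def]; linarith
  set γ : ℝ → ℝ := cellsGamma₂ c.base.wL c.cells with hγ
  set M : ℕ → ℂ := weilMoment a g with hM
  set n := c.base.N + 1 with hn
  set L := weilNorm1 g with hL
  have hn_even : Even n := ⟨c.base.nb, by omega⟩
  -- the pointwise bound (signed): S·γ + R·|γ|
  set W : ℕ → ℕ → ℝ := fun k l ↦
    (((-1 : ℂ) ^ k * I ^ (k + l)) * (conj (M k) * M l)).re with hW
  have hpt : ∀ t : ℝ, ‖weilMellin g (1 / 2 + t * I)‖ ^ 2 * γ t ≤
      (∑ k ∈ range n, ∑ l ∈ range n,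
        W k l * (a ^ (k + l) / (k.factorial * l.factorial)) * (γ t * t ^ (k + l))) +
        5 * L ^ 2 * (2 * a ^ n / n.factorial) * (|γ t| * t ^ n) := by
    intro t
    rcases lt_or_ge |t| (c.base.T : ℝ) with ht | ht
    · have ht1 : 2 * a * |t| ≤ c.base.N + 2 := by
        have h1 : 2 * a * |t| ≤ 2 * a * c.base.T := by nlinarith
        have h2 : (2 * c.base.a0 * c.base.T : ℝ) ≤ c.base.N + 2 := by exact_mod_cast haT
        rw [ha_def] at h1 ⊢; linarith
      have ht2 : 2 * (|t| * a) ^ (c.base.N + 1) / (c.base.N + 1).factorial ≤ 1 := by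
        have h1 : (|t| * a) ^ (c.base.N + 1) ≤ (c.base.T * a) ^ (c.base.N + 1) :=
          pow_le_pow_left₀ (by positivity) (by nlinarith) _
        have h2 : (2 * (c.base.a0 * c.base.T) ^ (c.base.N + 1) / (c.base.N + 1).factorial : ℝ) ≤ 1 := by
          exact_mod_cast hρT
        rw [ha_def] at h1 ⊢
        rw [mul_comm (c.base.a0 : ℝ)] at h2
        have h3 : 2 * (|t| * ↑c.base.a0) ^ (c.base.N + 1) / ((c.base.N + 1).factorial : ℝ) ≤
            2 * (↑c.base.T * ↑c.base.a0) ^ (c.base.N + 1) / ((c.base.N + 1).factorial : ℝ) := by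
          gcongr
        linarith
      have h := freq_pointwise_bound_abs hg ha hsupp c.base.N ht1 ht2
      set S : ℝ := ∑ k ∈ range (c.base.N + 1), ∑ l ∈ range (c.base.N + 1),
          (((-1 : ℂ) ^ k * I ^ (k + l)) * (conj (M k) * M l)).re *
            ((t * a) ^ (k + l) / (k.factorial * l.factorial)) with hS
      set R : ℝ := 5 * (2 * (|t| * a) ^ (c.base.N + 1) / (c.base.N + 1).factorial) * L ^ 2 with hR
      have hR0 : 0 ≤ R := by rw [hR]; positivity
      have hdiff : |‖weilMellin g (1 / 2 + t * I)‖ ^ 2 - S| ≤ R := by rw [hS, hR, hM]; exact h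
      -- `φ γ = S γ + (φ − S) γ ≤ S γ + R |γ|`
      have hkey : ‖weilMellin g (1 / 2 + t * I)‖ ^ 2 * γ t ≤ S * γ t + R * |γ t| := by
        have e : ‖weilMellin g (1 / 2 + t * I)‖ ^ 2 * γ t =
            S * γ t + (‖weilMellin g (1 / 2 + t * I)‖ ^ 2 - S) * γ t := by ring
        rw [e]
        have := abs_mul (‖weilMellin g (1 / 2 + t * I)‖ ^ 2 - S) (γ t)
        have h2 : |‖weilMellin g (1 / 2 + t * I)‖ ^ 2 - S| * |γ t| ≤ R * |γ t| :=
          mul_le_mul_of_nonneg_right hdiff (abs_nonneg _)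
        linarith [le_abs_self ((‖weilMellin g (1 / 2 + t * I)‖ ^ 2 - S) * γ t)]
      refine hkey.trans (le_of_eq ?_)
      congr 1
      · rw [hS, Finset.sum_mul, ← hn]
        refine Finset.sum_congr rfl fun k _ ↦ ?_
        rw [Finset.sum_mul]
        refine Finset.sum_congr rfl fun l _ ↦ ?_
        rw [hW, mul_pow]
        simp only
        ring
      · rw [hR, ← hn_even.pow_abs t, hn, mul_pow]
        ring
    · have h0 : γ t = 0 := cellsGamma₂_eq_zero hcells ht
      rw [h0]
      simp
  -- integrability of all terms
  obtain ⟨B, hB0, hB⟩ := exists_abs_cellsGamma₂_le c.base.wL c.cells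
  have hiL : Integrable fun t : ℝ ↦ ‖weilMellin g (1 / 2 + t * I)‖ ^ 2 * γ t :=
    integrable_norm_sq_weilMellin_mul hg (measurable_cellsGamma₂ _ _) hB0 le_rfl (B := 0)
      (fun t ↦ by simpa using hB t)
  have hiq : ∀ q, Integrable fun t ↦ γ t * t ^ q := fun q ↦ (integral_gamma_pow hcells q).1
  obtain ⟨hiabs, habsle⟩ := integral_abs_cellsGamma₂_mul_pow_le hcells hn_even
  have hiR : Integrable fun t ↦ (∑ k ∈ range n, ∑ l ∈ range n,
      W k l * (a ^ (k + l) / (k.factorial * l.factorial)) * (γ t * t ^ (k + l))) +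
      5 * L ^ 2 * (2 * a ^ n / n.factorial) * (|γ t| * t ^ n) := by
    refine Integrable.add (integrable_finsetSum _ fun k _ ↦ integrable_finsetSum _ fun l _ ↦
      (hiq (k + l)).const_mul _) (hiabs.const_mul _)
  have hint := integral_mono hiL hiR hpt
  refine hint.trans ?_
  rw [integral_add (integrable_finsetSum _ fun k _ ↦ integrable_finsetSum _ fun l _ ↦
      (hiq (k + l)).const_mul _) (hiabs.const_mul _),
    integral_finsetSum _ fun k _ ↦ integrable_finsetSum _ fun l _ ↦ (hiq (k + l)).const_mul _]
  refine add_le_add (le_of_eq ?_) ?_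
  · refine Finset.sum_congr rfl fun k _ ↦ ?_
    rw [integral_finsetSum _ fun l _ ↦ (hiq (k + l)).const_mul _]
    refine Finset.sum_congr rfl fun l _ ↦ ?_
    rw [integral_const_mul, (integral_gamma_pow hcells (k + l)).2, gHat]
    by_cases hkl : k % 2 = l % 2
    · have hev : Even (k + l) := (WeilCert.mod_two_eq_iff_even k l).1 hkl
      rw [if_pos hkl, if_pos hev, hW]
      simp only
      rw [WeilAna.I_pow_even hev,
        show ((-1 : ℂ) ^ k * (-1) ^ ((k + l) / 2)) * (conj (M k) * M l) =
          (((-1 : ℝ) ^ k * (-1) ^ ((k + l) / 2) : ℝ) : ℂ) * (conj (M k) * M l) by push_cast; ring,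
        Complex.re_ofReal_mul]
      unfold nuQ
      push_cast
      rw [hM, ha_def]
      ring
    · have hodd : ¬ Even (k + l) := fun h ↦ hkl ((WeilCert.mod_two_eq_iff_even k l).2 h)
      rw [if_neg hkl, if_neg hodd]
      simp
  · rw [integral_const_mul]
    have hfac : 0 ≤ 5 * L ^ 2 * (2 * a ^ n / n.factorial) := by positivity
    have := mul_le_mul_of_nonneg_left habsle hfac
    refine this.trans (le_of_eq ?_)
    unfold nuPrimeAbs
    push_cast
    rw [hn, ha_def]
    ring

/-! ### Step B: the minorant -/

/-- **Minorant bound.** `wL · 2π ‖g‖₂² − ∫ ‖ĝ‖² γ ≤ ∫ ‖ĝ(1/2+it)‖² w₂(t) dt` with the first-prime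
weight `w₂(t) = Re ψ(1/4 + it/2) − √2 log 2 cos(t log 2)`. [folklore] -/
theorem arch_lower_bound (hcells : checkCells₂ c.base.prec c.base.wL c.base.T c.base.mwT c.cells = true)
    (hg : IsWeilTest g) :
    (c.base.wL : ℝ) * (2 * π * weilNorm2Sq g) -
        ∫ t : ℝ, ‖weilMellin g (1 / 2 + t * I)‖ ^ 2 * cellsGamma₂ c.base.wL c.cells t ≤
      ∫ t : ℝ, ‖weilMellin g (1 / 2 + t * I)‖ ^ 2 *
        (Literature.Analysis.SpecialFunctions.reDigammaQuarter t -
          Real.sqrt 2 * Real.log 2 * Real.cos (t * Real.log 2)) := by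
  obtain ⟨B, hB0, hB⟩ := exists_abs_cellsGamma₂_le c.base.wL c.cells
  set σ : ℝ → ℝ := fun t ↦ (c.base.wL : ℝ) - cellsGamma₂ c.base.wL c.cells t with hσ
  have hσm : Measurable σ := measurable_const.sub (measurable_cellsGamma₂ _ _)
  have hσb : ∀ t, |σ t| ≤ (|(c.base.wL : ℝ)| + B) + 0 * t ^ 2 := fun t ↦ by
    rw [hσ, zero_mul, add_zero]
    exact (abs_sub _ _).trans (add_le_add le_rfl (hB t))
  have hle : ∀ t, σ t ≤ Literature.Analysis.SpecialFunctions.reDigammaQuarter t -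
      Real.sqrt 2 * Real.log 2 * Real.cos (t * Real.log 2) := fun t ↦ level_sub_cellsGamma₂_le hcells t
  have hi1 : Integrable fun t : ℝ ↦ ‖weilMellin g (1 / 2 + t * I)‖ ^ 2 * σ t :=
    integrable_norm_sq_weilMellin_mul hg hσm (by positivity) le_rfl hσb
  have hi2a := integrable_norm_sq_weilMellin_mul_reDigammaQuarter hg
  have hi2b : Integrable fun t : ℝ ↦
      ‖weilMellin g (1 / 2 + t * I)‖ ^ 2 * (Real.sqrt 2 * Real.log 2 * Real.cos (t * Real.log 2)) :=
    integrable_norm_sq_weilMellin_mul hg (by fun_prop) (A := Real.sqrt 2 * Real.log 2) (B := 0)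
      (by positivity) le_rfl fun t ↦ by
        rw [zero_mul, add_zero, abs_mul, abs_of_nonneg (by positivity : (0 : ℝ) ≤ Real.sqrt 2 * Real.log 2)]
        exact mul_le_of_le_one_right (by positivity) (Real.abs_cos_le_one _)
  have hi2 : Integrable fun t : ℝ ↦ ‖weilMellin g (1 / 2 + t * I)‖ ^ 2 *
      (Literature.Analysis.SpecialFunctions.reDigammaQuarter t -
        Real.sqrt 2 * Real.log 2 * Real.cos (t * Real.log 2)) := by
    have e : (fun t : ℝ ↦ ‖weilMellin g (1 / 2 + t * I)‖ ^ 2 *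
        (Literature.Analysis.SpecialFunctions.reDigammaQuarter t -
          Real.sqrt 2 * Real.log 2 * Real.cos (t * Real.log 2))) =
        fun t : ℝ ↦ ‖weilMellin g (1 / 2 + t * I)‖ ^ 2 * Literature.Analysis.SpecialFunctions.reDigammaQuarter t -
          ‖weilMellin g (1 / 2 + t * I)‖ ^ 2 * (Real.sqrt 2 * Real.log 2 * Real.cos (t * Real.log 2)) := by
      funext t; ring
    rw [e]; exact hi2a.sub hi2b
  have h := integral_mono hi1 hi2 fun t ↦ mul_le_mul_of_nonneg_left (hle t) (sq_nonneg _)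
  refine le_trans (le_of_eq ?_) h
  have hj1 := integrable_norm_sq_weilMellin_half_line hg
  have hj2 : Integrable fun t : ℝ ↦ ‖weilMellin g (1 / 2 + t * I)‖ ^ 2 * cellsGamma₂ c.base.wL c.cells t :=
    integrable_norm_sq_weilMellin_mul hg (measurable_cellsGamma₂ _ _) hB0 le_rfl (B := 0)
      (fun t ↦ by simpa using hB t)
  have e : (fun t : ℝ ↦ ‖weilMellin g (1 / 2 + t * I)‖ ^ 2 * σ t) = fun t : ℝ ↦
      (c.base.wL : ℝ) * ‖weilMellin g (1 / 2 + t * I)‖ ^ 2 -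
        ‖weilMellin g (1 / 2 + t * I)‖ ^ 2 * cellsGamma₂ c.base.wL c.cells t := by
    funext t; rw [hσ]; ring
  rw [e, integral_sub (hj1.const_mul _) hj2, integral_const_mul,
    integral_norm_sq_weilMellin_half_line hg]

/-- Entry identity: `(pmQ k l : ℝ) = Sym_{kl} − q Ĝ_{kl}` for `k, l ≤ N`. [folklore] -/
theorem pmQ_cast (hnu : c.checkNu = true) {k l : ℕ} (hk : k < c.base.N + 1) (hl : l < c.base.N + 1) :
    ((c.base.pmQ c.nuTab k l : ℚ) : ℝ) =
      (if k % 2 = l % 2 then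
        (-1 : ℝ) ^ k * 2 * (((c.base.a0 : ℝ) / 2) ^ k / k.factorial) * (((c.base.a0 : ℝ) / 2) ^ l / l.factorial)
        else 0) -
      ((invTwoPiHi : ℚ) : ℝ) * gHat c k l := by
  unfold WeilCert.pmQ gHat
  by_cases hkl : k % 2 = l % 2
  · rw [if_pos hkl, if_pos hkl, if_pos hkl, getV_nuTab hnu (by omega) (by omega)]
    push_cast
    rw [WeilCert.tauQ_cast, WeilCert.tauQ_cast]
  · rw [if_neg hkl, if_neg hkl, if_neg hkl]
    all_goals simp

/-! ### The main theorem -/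

set_option maxHeartbeats 1600000 in
/-- **Soundness of the first-prime certificate.** If `c.check = true` then the first-prime
analytic form is non-negative on `C(b)`: for every test function `g` with `tsupport g ⊆ [-b, b]`,
`0 ≤ 2 Re(ĝ(0) conj ĝ(1)) − (log π)‖g‖₂² + (1/2π) ∫ |ĝ(1/2+it)|² w₂(t) dt` (`= E₂(g)`,
`Literature.NumberTheory.LFunctions.weilFirstPrimeQuadratic`; for `b ≤ (log 3)/2` this is
`Re W(g ⋆ g̃)`, `weilQuadratic_re_eq_weilFirstPrimeQuadratic`). [folklore] -/
theorem weilFirstPrimeQuadratic_nonneg_of_check (h : c.check = true) {g : ℝ → ℂ} (hg : IsWeilTest g)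
    (hsupp : tsupport g ⊆ Icc (-(c.b : ℝ)) c.b) :
    0 ≤ 2 * (weilMellin g 0 * conj (weilMellin g 1)).re - Real.log π * weilNorm2Sq g +
      1 / (2 * π) * ∫ t : ℝ, ‖weilMellin g (1 / 2 + t * I)‖ ^ 2 *
        (Literature.Analysis.SpecialFunctions.reDigammaQuarter t -
          Real.sqrt 2 * Real.log 2 * Real.cos (t * Real.log 2)) := by
  obtain ⟨hcells, hsc, hnuchk, hb0, hb1⟩ := check_spec h
  obtain ⟨hbpos, hba, ha1q, hT, haT, hρT, hN, hκ⟩ := scalars_spec hsc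
  set a : ℝ := (c.base.a0 : ℝ) with ha_def
  have hba' : ((c.b : ℚ) : ℝ) ≤ a := by rw [ha_def]; exact_mod_cast hba
  have hb0' : (0 : ℝ) < c.b := by exact_mod_cast hbpos
  have ha : 0 < a := by linarith
  have ha1 : a ≤ 1 := by rw [ha_def]; exact_mod_cast ha1q
  have hsupp' : tsupport g ⊆ Icc (-a) a := hsupp.trans (Icc_subset_Icc (by linarith) hba')
  set n := c.base.N + 1 with hn
  set nu := c.nuTab with hnu
  set M : ℕ → ℂ := weilMoment a g with hM
  set L := weilNorm1 g with hL
  set N2 := weilNorm2Sq g with hN2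
  set z : ℕ → ℕ → ℝ := fun k l ↦ (conj (M k) * M l).re with hz
  have hzsym : ∀ k l, z k l = z l k := fun k l ↦ by
    rw [hz]; simp only; rw [← WeilAna.re_mul_conj_eq, mul_comm]
  have hL0 : 0 ≤ L := weilNorm1_nonneg g
  have hN20 : 0 ≤ N2 := weilNorm2Sq_nonneg g
  have hL1 : L ^ 2 ≤ 2 * a * N2 := weilNorm1_sq_le hg ha hsupp'
  -- the three terms of E(g)
  set P : ℝ := 2 * (weilMellin g 0 * conj (weilMellin g 1)).re with hP
  set A : ℝ := ∫ t : ℝ, ‖weilMellin g (1 / 2 + t * I)‖ ^ 2 *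
    (Literature.Analysis.SpecialFunctions.reDigammaQuarter t - Real.sqrt 2 * Real.log 2 * Real.cos (t * Real.log 2)) with hA
  set Γ : ℝ := ∫ t : ℝ, ‖weilMellin g (1 / 2 + t * I)‖ ^ 2 * cellsGamma₂ c.base.wL c.cells t with hΓ
  -- Step A
  set ρ : ℝ := 2 * (a / 2) ^ (c.base.N + 1) / (c.base.N + 1).factorial with hρ
  have hρ0 : 0 ≤ ρ := by positivity
  have hPA : ∑ k ∈ range n, ∑ l ∈ range n,
      (2 * ((-a / 2) ^ k / k.factorial) * ((a / 2) ^ l / l.factorial)) * z k l -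
      (8 * ρ + 6 * ρ ^ 2) * L ^ 2 ≤ P := WeilAna.polar_lower_bound hg ha ha1 hsupp' c.base.N
  rw [WeilCert.polar_symmetrize n a z hzsym] at hPA
  -- Step B
  have hB : (c.base.wL : ℝ) * (2 * π * N2) - Γ ≤ A := arch_lower_bound hcells hg
  -- Step C
  have hC : Γ ≤ ∑ k ∈ range n, ∑ l ∈ range n, gHat c k l * z k l + 5 * L ^ 2 * (c.nuPrimeAbs : ℝ) := by
    have := freq_integral_bound hcells hsc hg (by rwa [← ha_def])
    rw [← ha_def] at this
    exact this
  -- constants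
  set q : ℝ := ((invTwoPiHi : ℚ) : ℝ) with hq
  set qLo : ℝ := ((invTwoPiLo20 : ℚ) : ℝ) with hqLo
  have hq1 : 1 / (2 * π) ≤ q := invTwoPiHi_ge
  have hq0 : 0 ≤ q := invTwoPiHi_nonneg
  have hqLo1 : qLo ≤ 1 / (2 * π) := invTwoPiLo20_le
  have hlogpi : Real.log π ≤ ((logPiHi : ℚ) : ℝ) := logPiHi_ge
  have hν0 : 0 ≤ ((c.nuPrimeAbs : ℚ) : ℝ) := by
    unfold nuPrimeAbs
    have h1 : (0 : ℝ) ≤ (cellsAbsMomentQ c.base.wL c.cells (c.base.N + 1) : ℝ) := by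
      rw [← (integral_stepAux_mul_pow (wL := c.base.wL) (checkCells₂_spec hcells).2.1 (c.base.N + 1)).2]
      refine integral_nonneg fun s' ↦ mul_nonneg ((stepAux_props (wL := c.base.wL)
        (checkCells₂_spec hcells).2.1).1.choose_spec s').1 ?_
      have hev : Even (c.base.N + 1) := ⟨c.base.nb, by omega⟩
      rw [← hev.pow_abs]; positivity
    push_cast
    have ha0 : (0 : ℝ) ≤ (c.base.a0 : ℝ) := by rw [← ha_def]; exact ha.le
    positivity
  have hpi : 0 < 1 / (2 * π) := by positivity
  -- the signed `Γ`: `−(1/2π)Γ ≥ −qX − (q − qLo)·C₀·7·N2`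
  set C₀ : ℝ := ((cellsBndSumQ c.base.wL c.cells : ℚ) : ℝ) with hC₀
  have hC₀0 : 0 ≤ C₀ := by rw [hC₀]; exact cellsBndSumQ_nonneg (checkCells₂_spec hcells).2.1
  have hγabs : ∀ t, |cellsGamma₂ c.base.wL c.cells t| ≤ C₀ := fun t ↦ by
    rw [hC₀]; exact abs_cellsGamma₂_le_bndSum hcells t
  set ind : ℝ → ℝ := Set.indicator (Icc (-(c.base.T : ℝ)) c.base.T) (fun _ ↦ (1 : ℝ)) with hind
  have hind01 : ∀ t, 0 ≤ ind t ∧ ind t ≤ 1 := fun t ↦ by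
    rw [hind]; by_cases ht : t ∈ Icc (-(c.base.T : ℝ)) c.base.T
    · rw [Set.indicator_of_mem ht]; norm_num
    · rw [Set.indicator_of_notMem ht]; norm_num
  have hindm : Measurable ind := by rw [hind]; exact measurable_const.indicator measurableSet_Icc
  set PiT : ℝ := ∫ t : ℝ, ‖weilMellin g (1 / 2 + t * I)‖ ^ 2 * ind t with hPiT
  have hiPiT : Integrable fun t : ℝ ↦ ‖weilMellin g (1 / 2 + t * I)‖ ^ 2 * ind t :=
    integrable_norm_sq_weilMellin_mul hg hindm (A := 1) (B := 0) zero_le_one le_rfl fun t ↦ by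
      rw [zero_mul, add_zero, abs_of_nonneg (hind01 t).1]; exact (hind01 t).2
  obtain ⟨BΓ, hBΓ0, hBΓ⟩ := exists_abs_cellsGamma₂_le c.base.wL c.cells
  have hiΓ : Integrable fun t : ℝ ↦ ‖weilMellin g (1 / 2 + t * I)‖ ^ 2 * cellsGamma₂ c.base.wL c.cells t :=
    integrable_norm_sq_weilMellin_mul hg (measurable_cellsGamma₂ _ _) hBΓ0 le_rfl (B := 0)
      (fun t ↦ by simpa using hBΓ t)
  have hPiT0 : 0 ≤ PiT := integral_nonneg fun t ↦ mul_nonneg (sq_nonneg _) (hind01 t).1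
  have hPiTle : PiT ≤ 7 * N2 := by
    have h1 : PiT ≤ ∫ t : ℝ, ‖weilMellin g (1 / 2 + t * I)‖ ^ 2 :=
      integral_mono hiPiT (integrable_norm_sq_weilMellin_half_line hg) fun t ↦ by
        simpa using mul_le_mul_of_nonneg_left (hind01 t).2 (sq_nonneg ‖weilMellin g (1 / 2 + t * I)‖)
    rw [integral_norm_sq_weilMellin_half_line hg] at h1
    have h7 : 2 * π ≤ 7 := by linarith [Real.pi_lt_d2]
    nlinarith
  -- `Γ₊ = Γ + C₀ PiT ≥ 0`
  have hΓplus : 0 ≤ Γ + C₀ * PiT := by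
    rw [hΓ, hPiT, ← integral_const_mul, ← integral_add hiΓ (hiPiT.const_mul _)]
    refine integral_nonneg fun t ↦ ?_
    rw [show ‖weilMellin g (1 / 2 + t * I)‖ ^ 2 * cellsGamma₂ c.base.wL c.cells t +
        C₀ * (‖weilMellin g (1 / 2 + t * I)‖ ^ 2 * ind t) =
        ‖weilMellin g (1 / 2 + t * I)‖ ^ 2 * (cellsGamma₂ c.base.wL c.cells t + C₀ * ind t) by ring]
    refine mul_nonneg (sq_nonneg _) ?_
    by_cases ht : t ∈ Icc (-(c.base.T : ℝ)) c.base.T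
    · have : ind t = 1 := by rw [hind, Set.indicator_of_mem ht]
      rw [this, mul_one]
      linarith [neg_abs_le (cellsGamma₂ c.base.wL c.cells t), hγabs t]
    · have : ind t = 0 := by rw [hind, Set.indicator_of_notMem ht]
      have hT' : (c.base.T : ℝ) ≤ |t| := by
        rw [Set.mem_Icc, not_and_or, not_le, not_le] at ht
        rcases ht with ht | ht
        · linarith [neg_abs_le t, le_abs_self t, neg_le_abs t]
        · exact ht.le.trans (le_abs_self t)
      rw [this, mul_zero, add_zero, cellsGamma₂_eq_zero hcells hT']
  have hΓlow : -(q * (∑ k ∈ range n, ∑ l ∈ range n, gHat c k l * z k l + 5 * L ^ 2 * (c.nuPrimeAbs : ℝ))) -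
      (q - qLo) * C₀ * (7 * N2) ≤ -(1 / (2 * π) * Γ) := by
    have e : -(1 / (2 * π) * Γ) = -(1 / (2 * π)) * (Γ + C₀ * PiT) + 1 / (2 * π) * (C₀ * PiT) := by ring
    rw [e]
    have h1 : -q * (Γ + C₀ * PiT) ≤ -(1 / (2 * π)) * (Γ + C₀ * PiT) := by nlinarith
    have h2 : qLo * (C₀ * PiT) ≤ 1 / (2 * π) * (C₀ * PiT) :=
      mul_le_mul_of_nonneg_right hqLo1 (mul_nonneg hC₀0 hPiT0)
    have h3 : q * Γ ≤ q * (∑ k ∈ range n, ∑ l ∈ range n, gHat c k l * z k l + 5 * L ^ 2 * (c.nuPrimeAbs : ℝ)) :=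
      mul_le_mul_of_nonneg_left hC hq0
    have hqq : 0 ≤ q - qLo := by linarith [invTwoPiLo20_le.trans invTwoPiHi_ge]
    have h4 : (q - qLo) * C₀ * PiT ≤ (q - qLo) * C₀ * (7 * N2) :=
      mul_le_mul_of_nonneg_left hPiTle (mul_nonneg hqq hC₀0)
    nlinarith
  -- combine A, B, C
  have hB' : (c.base.wL : ℝ) * N2 - 1 / (2 * π) * Γ ≤ 1 / (2 * π) * A := by
    calc (c.base.wL : ℝ) * N2 - 1 / (2 * π) * Γ = 1 / (2 * π) * ((c.base.wL : ℝ) * (2 * π * N2) - Γ) := by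
          field_simp
      _ ≤ 1 / (2 * π) * A := mul_le_mul_of_nonneg_left hB hpi.le
  have h5 : Real.log π * N2 ≤ ((logPiHi : ℚ) : ℝ) * N2 := mul_le_mul_of_nonneg_right hlogpi hN20
  have step1 : ∑ k ∈ range n, ∑ l ∈ range n,
      ((if k % 2 = l % 2 then
        (-1 : ℝ) ^ k * 2 * ((a / 2) ^ k / k.factorial) * ((a / 2) ^ l / l.factorial) else 0) -
        q * gHat c k l) * z k l +
      ((c.base.wL : ℝ) - (logPiHi : ℚ) - 7 * (q - qLo) * C₀) * N2 -
      ((8 * ρ + 6 * ρ ^ 2) + 5 * q * (c.nuPrimeAbs : ℝ)) * L ^ 2 ≤ P - Real.log π * N2 + 1 / (2 * π) * A := by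
    have e1 : ∑ k ∈ range n, ∑ l ∈ range n,
        ((if k % 2 = l % 2 then
          (-1 : ℝ) ^ k * 2 * ((a / 2) ^ k / k.factorial) * ((a / 2) ^ l / l.factorial) else 0) -
          q * gHat c k l) * z k l =
        ∑ k ∈ range n, ∑ l ∈ range n,
          (if k % 2 = l % 2 then
            (-1 : ℝ) ^ k * 2 * ((a / 2) ^ k / k.factorial) * ((a / 2) ^ l / l.factorial) else 0) * z k l -
        q * ∑ k ∈ range n, ∑ l ∈ range n, gHat c k l * z k l := by
      rw [Finset.mul_sum, ← Finset.sum_sub_distrib]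
      refine Finset.sum_congr rfl fun k _ ↦ ?_
      rw [Finset.mul_sum, ← Finset.sum_sub_distrib]
      refine Finset.sum_congr rfl fun l _ ↦ ?_
      ring
    rw [e1]
    linarith [hPA, hB', hΓlow, h5]
  -- rewrite the matrix as `pmQ`
  have step2 : ∑ k ∈ range n, ∑ l ∈ range n,
      ((if k % 2 = l % 2 then
        (-1 : ℝ) ^ k * 2 * ((a / 2) ^ k / k.factorial) * ((a / 2) ^ l / l.factorial) else 0) -
        q * gHat c k l) * z k l =
      ∑ k ∈ range n, ∑ l ∈ range n, ((c.base.pmQ nu k l : ℚ) : ℝ) * z k l := by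
    refine Finset.sum_congr rfl fun k hk ↦ Finset.sum_congr rfl fun l hl ↦ ?_
    rw [pmQ_cast hnuchk (Finset.mem_range.1 hk) (Finset.mem_range.1 hl)]
  rw [step2] at step1
  -- rounding
  have hMk : ∀ k, ‖M k‖ ≤ L := fun k ↦ norm_weilMoment_le hg ha hsupp' k
  have hround : ∑ k ∈ range n, ∑ l ∈ range n, ((c.base.prQ nu k l : ℚ) : ℝ) * z k l -
      ∑ k ∈ range n, ∑ l ∈ range n, ((c.base.pmQ nu k l : ℚ) : ℝ) * z k l ≤
      1 / 2 ^ c.base.pg * (n : ℝ) ^ 2 * L ^ 2 :=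
    WeilAlg.quad_rounding_le n (fun k l ↦ ((c.base.prQ nu k l : ℚ) : ℝ))
      (fun k l ↦ ((c.base.pmQ nu k l : ℚ) : ℝ)) (1 / 2 ^ c.base.pg) L (fun k l ↦ by
        rw [abs_sub_comm]
        unfold WeilCert.prQ
        exact abs_cast_sub_ratRd_le c.base.pg (c.base.pmQ nu k l)) M hMk
  -- κ_exact
  have hcoef : 0 ≤ (8 * ρ + 6 * ρ ^ 2) + 5 * q * (c.nuPrimeAbs : ℝ) + 1 / 2 ^ c.base.pg * (n : ℝ) ^ 2 :=
    add_nonneg (add_nonneg (by positivity) (mul_nonneg (mul_nonneg (by norm_num) hq0) hν0)) (by positivity)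
  have hkex : ((c.kappaExact : ℚ) : ℝ) =
      ((c.base.wL : ℝ) - (logPiHi : ℚ) - 7 * (q - qLo) * C₀) -
        2 * a * ((8 * ρ + 6 * ρ ^ 2) + 5 * q * (c.nuPrimeAbs : ℝ) + 1 / 2 ^ c.base.pg * (n : ℝ) ^ 2) := by
    rw [hρ, hq, hqLo, hC₀, hn, ha_def]
    unfold kappaExact WeilCert.etaP WeilCert.rhoE
    push_cast
    ring
  have hκle : ((c.kappaQ : ℚ) : ℝ) ≤ ((c.kappaExact : ℚ) : ℝ) := by
    unfold kappaQ; exact_mod_cast ratRd_le c.base.pg _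
  have hκ0 : (0 : ℝ) ≤ ((c.kappaQ : ℚ) : ℝ) := by exact_mod_cast hκ
  -- E ≥ Σ pr z + κ N2
  have step3 : ∑ k ∈ range n, ∑ l ∈ range n, ((c.base.prQ nu k l : ℚ) : ℝ) * z k l +
      ((c.kappaQ : ℚ) : ℝ) * N2 ≤ P - Real.log π * N2 + 1 / (2 * π) * A := by
    have h1 : ((c.kappaQ : ℚ) : ℝ) * N2 ≤ ((c.kappaExact : ℚ) : ℝ) * N2 :=
      mul_le_mul_of_nonneg_right hκle hN20
    rw [hkex] at h1
    have h2 := mul_le_mul_of_nonneg_left hL1 hcoef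
    linarith [step1, hround, h1, h2]
  -- Bessel and the algebraic core
  have hbes : 2 * (∑ k ∈ range n, conj (c.base.uVec M k) * M k).re -
      (∑ k ∈ range n, ∑ l ∈ range n, conj (c.base.uVec M k) * c.base.uVec M l * (gramH a k l : ℂ)).re ≤ N2 :=
    weilNorm2Sq_ge_bessel hg ha hsupp' n (c.base.uVec M)
  have hcore : 0 ≤ (∑ k ∈ range n, ∑ l ∈ range n, ((c.base.prQ nu k l : ℚ) : ℝ) * z k l) +
      ((c.kappaQ : ℚ) : ℝ) *
        (2 * (∑ k ∈ range n, conj (c.base.uVec M k) * M k).re -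
          (∑ k ∈ range n, ∑ l ∈ range n,
            conj (c.base.uVec M k) * c.base.uVec M l * (gramH a k l : ℂ)).re) := by
    have := WeilCert.core_nonnegK (c := c.base) (nu := nu) (κ := c.kappaQ) hN hb0 hb1 a ha_def.symm M
    rw [← hn] at this
    exact this
  have h4 := mul_le_mul_of_nonneg_left hbes hκ0
  linarith [step3, h4, hcore]


end WeilCert2

end Literature.NumberTheory.LFunctions
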